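import Summits.CriticalPhenomena.PercolationContinuityZ3.Theorems.PercNearOneGluingNoHeavyPcintAdaptiveDominationTools
import Summits.CriticalPhenomena.PercolationContinuityZ3.Theorems.PercNearOneGluingNoHeavyPcintClusterExploration
import HarnessLib

/-!
# PCINT lane, T-fibre route PHASE 3 (bond), step (0): generic run lemmas of an exploration rule

Cell `prim-pcint`, seat `prim-pcint-1` (gen 13); memo `run/shared/lean/prim/pcint/T-FIBRE-ROUTE.md` (PHASE 3).

For an ARBITRARY exploration rule `R` examining only unrevealed items (`hR`, the hypothesis of
`AdaptDom.expect_le_of_dominating`) and any oracle `x`: termination after `|V| + 1` steps (`AdaptDom.run_terminal`),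
an item is examined at most once (`step_unique`), a revealed item was examined before (`exists_step_of_ne_none`), an item
unrevealed at step `n` was not examined before (`not_mem_of_run_apply_eq_none`), and the recorded value is the oracle's
report (`run_apply_of_mem`).  These are the rule-independent versions of the lemmas of `…PcintClusterExplorationRun.lean`
(stated there for the site rule `ClusterExpl.rule`); the bond route runs them with the edge rule `EdgeExpl.rule`.
-/

namespace Summit.CriticalPhenomena.PercolationContinuityZ3.Theorems.Pcint

open Finset

/-! ### Generic run lemmas for a rule examining only unrevealed items -/

namespace AdaptDom

variable {V : Type*} [Fintype V] [DecidableEq V] {R : (V → Option Bool) → Finset V}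

omit [Fintype V] in
/-- A step with an empty examination set does nothing. -/
theorem run_succ_of_empty (x : (V → Option Bool) → V → Bool) {k : ℕ} (h : R (run R x k) = ∅) : run R x (k + 1) = run R x k := by
  change stepPA (R (run R x k)) (run R x k) (x (run R x k)) = run R x k
  rw [h]; funext v; simp [stepPA]

omit [Fintype V] in
/-- Once the rule is empty, the run is constant. -/
theorem run_eq_of_empty (x : (V → Option Bool) → V → Bool) {k : ℕ} (h : R (run R x k) = ∅) : ∀ n, k ≤ n → run R x n = run R x k := by
  intro n hn
  induction n with
  | zero => obtain rfl : k = 0 := Nat.le_zero.1 hn; rfl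
  | succ n ih =>
    rcases Nat.lt_or_eq_of_le hn with hlt | heq
    · have ih' := ih (Nat.lt_succ_iff.1 hlt)
      rw [run_succ_of_empty x (by rw [ih']; exact h), ih']
    · rw [← heq]

/-- A step with a nonempty examination set reveals strictly more items (`ClusterExpl.nrev` counts revealed items). -/
theorem nrev_lt_succ (hR : ∀ σ v, v ∈ R σ → σ v = none) (x : (V → Option Bool) → V → Bool) {k : ℕ}
    (hne : (R (run R x k)).Nonempty) : ClusterExpl.nrev (run R x k) < ClusterExpl.nrev (run R x (k + 1)) :=
  ClusterExpl.nrev_lt_nrev_stepPA (hR _) hne (x (run R x k))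

/-- Along a run, either some state up to step `n` is terminal or at least `n + 1` items are revealed at step `n + 1`. -/
theorem nrev_run_ge (hR : ∀ σ v, v ∈ R σ → σ v = none) (x : (V → Option Bool) → V → Bool) :
    ∀ n : ℕ, (∃ k ≤ n, R (run R x k) = ∅) ∨ n + 1 ≤ ClusterExpl.nrev (run R x (n + 1))
  | 0 => by
    by_cases h : R (run R x 0) = ∅
    · exact Or.inl ⟨0, le_rfl, h⟩
    · have := nrev_lt_succ hR x (k := 0) (nonempty_iff_ne_empty.2 h); omega
  | n + 1 => by
    rcases nrev_run_ge hR x n with ⟨k, hk, hke⟩ | hge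
    · exact Or.inl ⟨k, hk.trans (Nat.le_succ n), hke⟩
    · by_cases h : R (run R x (n + 1)) = ∅
      · exact Or.inl ⟨n + 1, le_rfl, h⟩
      · have := nrev_lt_succ hR x (k := n + 1) (nonempty_iff_ne_empty.2 h); omega

/-- **Termination**: after `|V| + 1` steps every run of a rule examining only unrevealed items is terminal. -/
theorem run_terminal (hR : ∀ σ v, v ∈ R σ → σ v = none) (x : (V → Option Bool) → V → Bool) :
    R (run R x (Fintype.card V + 1)) = ∅ := by
  rcases nrev_run_ge hR x (Fintype.card V) with ⟨k, hk, hke⟩ | hge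
  · rw [run_eq_of_empty x hke _ (hk.trans (Nat.le_succ _))]; exact hke
  · have : ClusterExpl.nrev (run R x (Fintype.card V + 1)) ≤ Fintype.card V := by
      unfold ClusterExpl.nrev; exact card_le_univ _
    omega

omit [Fintype V] in
/-- An unrevealed item was unrevealed before. -/
theorem run_apply_eq_none_of_le' (hR : ∀ σ v, v ∈ R σ → σ v = none) (x : (V → Option Bool) → V → Bool) {k n : ℕ} (hkn : k ≤ n) {a : V} (ha : run R x n a = none) : run R x k a = none := by
  by_contra h
  have := run_apply_of_ne_none hR x h n hkn
  rw [ha] at this; exact h this.symm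

omit [Fintype V] in
/-- An item unrevealed at step `n` was not examined before. -/
theorem not_mem_of_run_apply_eq_none (hR : ∀ σ v, v ∈ R σ → σ v = none) (x : (V → Option Bool) → V → Bool) {k n : ℕ} (hkn : k < n) {a : V} (ha : run R x n a = none) : a ∉ R (run R x k) := by
  intro h
  have h1 := run_succ_apply_of_mem x k h
  have h2 := run_apply_eq_none_of_le' hR x (Nat.succ_le_of_lt hkn) ha
  rw [h1] at h2; exact absurd h2 (by simp)

omit [Fintype V] in
/-- A revealed item was examined at some earlier step. -/
theorem exists_step_of_ne_none (x : (V → Option Bool) → V → Bool) : ∀ (n : ℕ) (a : V), run R x n a ≠ none → ∃ k < n, a ∈ R (run R x k)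
  | 0, a, ha => absurd rfl ha
  | n + 1, a, ha => by
    by_cases h : a ∈ R (run R x n)
    · exact ⟨n, Nat.lt_succ_self n, h⟩
    · have : run R x (n + 1) a = run R x n a := by
        change stepPA (R (run R x n)) (run R x n) (x (run R x n)) a = _
        simp [stepPA, h]
      rw [this] at ha
      obtain ⟨k, hk, hka⟩ := exists_step_of_ne_none x n a ha
      exact ⟨k, hk.trans (Nat.lt_succ_self n), hka⟩

omit [Fintype V] in
/-- An item is examined at most once. -/
theorem step_unique (hR : ∀ σ v, v ∈ R σ → σ v = none) (x : (V → Option Bool) → V → Bool) {j k : ℕ} {a : V} (hj : a ∈ R (run R x j)) (hk : a ∈ R (run R x k)) : j = k := by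
  by_contra hne
  rcases Nat.lt_or_gt_of_ne hne with h | h
  · exact not_mem_of_run_apply_eq_none hR x h (hR _ a hk) hj
  · exact not_mem_of_run_apply_eq_none hR x h (hR _ a hj) hk

omit [Fintype V] in
/-- The value recorded for an item examined at step `k` is the oracle's report, at every later step. -/
theorem run_apply_of_mem (hR : ∀ σ v, v ∈ R σ → σ v = none) (x : (V → Option Bool) → V → Bool) {k n : ℕ} (hkn : k < n) {a : V} (ha : a ∈ R (run R x k)) :
    run R x n a = some (x (run R x k) a) := by
  have h1 := run_succ_apply_of_mem x k ha
  rw [← h1]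
  exact run_apply_of_ne_none hR x (by rw [h1]; simp) n (Nat.succ_le_of_lt hkn)

end AdaptDom

end Summit.CriticalPhenomena.PercolationContinuityZ3.Theorems.Pcint
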